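import Summits.CriticalPhenomena.PercolationContinuityZ3.Theorems.Transplant.BarlowContactGraph
import Summits.CriticalPhenomena.PercolationContinuityZ3.Theorems.Transplant.StatementCubicLattices
import Summits.CriticalPhenomena.PercolationContinuityZ3.Theorems.Transplant.SkeletonConcProductsHolds
import HarnessLib

/-!
# The `3C` member of the Barlow family IS the fcc lattice: `Barlow.contactGraph constHagg ≃g fccGraph`, hence `θ(p_c) = 0` on the contact graph
# of the cubic close packing of unit balls (`ABCABC…`), at every ball — unconditional

builds on p205010 (kernel theorem, internal audit signed; external expert review pending): §3 applies the lane's fcc theorem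
`fcc_criticalContinuity_holds` (`Transplant/SkeletonConcProductsHolds.lean`, via the general skeleton node `samePDropOfSkeletonConcLt_holds`, whose cone
contains p205010); §1–§2 use nothing of it.
Status sentence (coordinator 2026-08-20T04:30Z): "θ(p_c) = 0 on ℤ^d, all d ≥ 2 — kernel-verified (Lean 4/Mathlib, standard axioms); internal
adversarial audit SIGNED 2026-08-20 04:29Z; external expert review pending."
Lane `prim-bschramm-*`, seat `prim-bschramm-stmt` (gen 11); DEFINITION-FAITHFULNESS certificate for the lane's fcc headline (V101: `FccOwnCriticalContinuity`
over `fccGraph = (distSqGraph 3 2).induce {x : Σ xᵢ even}`, the cubic frame) in the sphere-packing vocabulary of the Literature (`barlowPos`,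
L-SM/BarlowStacking.lean; `constHagg` = the `ABC…` stacking, L-SM/HaggStacking.lean).

* §1 the ℤ-linear relabelling `Barlow.toFcc (k, i, j) = (i + j, −k − i, −k − j)` (layer generators `u = (1,−1,0)`, `v = (1,0,−1)`, interlayer
  `w = (0,−1,−1)`; coordinate sum `−2k`), its inverse `Barlow.ofFcc x = (−Σ/2, −x₁ + Σ/2, −x₂ + Σ/2)` on even-sum points, `Barlow.fccEquiv : ℤ³ ≃ fccSite`;
* §2 the shell in these coordinates: `Barlow.sq_eq_two_iff_shell` (`(a+b)² + (a+c)² + (b+c)² = 2` iff `(c, (a, b))` is one of the twelve `ABC` contacts —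
  bounding to `{−1,0,1}³` then `decide`), **`Barlow.fccIso : contactGraph constHagg ≃g fccGraph`** ("the fcc lattice is the contact graph of the cubic
  close packing");
* §3 **`Barlow.cubic_criticalContinuity`**: `θ_v(p_c(v)) = 0` at every ball of the `ABC` contact graph (transport of `fcc_criticalContinuity_holds` along
  `fccIso` by `theta_iso`/`criticalProb_iso`) — the `3C` member of TARGET 2t′ (`BarlowStackingCriticalContinuity`, `Transplant/BarlowPolytypes.lean`) is a
  theorem; the `2H` member (hcp, TARGET 2t) stays open.
[cite: ConwaySloane1999, Ch. 1 §1.3–§1.4 (fcc = the ABC stacking = D₃)] [cite: HalesDSP2012, §1.3] [cite: BenjaminiSchramm1996, Conj. 4]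
-/

noncomputable section

namespace Summit.CriticalPhenomena.PercolationContinuityZ3.Theorems.Transplant

open MeasureTheory Literature.Probability.Percolation Literature.Probability.LatticeModels
open Literature.MathematicalPhysics.StatisticalMechanics (IsHaggSeq constHagg sixOffsets threeOffsets isHaggSeq_const)

namespace Barlow

/-! ## §1 The linear relabelling `ℤ³ ≃ D₃` -/

/-- The cubic-frame coordinates of the ball `(k, i, j)` of the `ABC` stacking: `k w + i u + j v` with `u = (1,−1,0)`, `v = (1,0,−1)`,
`w = (0,−1,−1)` — `(i + j, −k − i, −k − j)`. [cite: ConwaySloane1999, Ch. 1 §1.4] -/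
def toFcc (v : ℤ × ℤ × ℤ) : Site 3 := ![v.2.1 + v.2.2, -v.1 - v.2.1, -v.1 - v.2.2]

/-- Components of `toFcc`. [folklore] -/
@[simp] theorem toFcc_zero (v : ℤ × ℤ × ℤ) : toFcc v 0 = v.2.1 + v.2.2 := rfl
/-- Components of `toFcc`. [folklore] -/
@[simp] theorem toFcc_one (v : ℤ × ℤ × ℤ) : toFcc v 1 = -v.1 - v.2.1 := rfl
/-- Components of `toFcc`. [folklore] -/
@[simp] theorem toFcc_two (v : ℤ × ℤ × ℤ) : toFcc v 2 = -v.1 - v.2.2 := rfl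

/-- The coordinate sum of `toFcc (k, i, j)` is `−2k`, so the image lies in `D₃`. [folklore] -/
theorem toFcc_mem (v : ℤ × ℤ × ℤ) : toFcc v ∈ fccSite := by
  rw [mem_fccSite_iff, toFcc_zero, toFcc_one, toFcc_two]
  exact ⟨-v.1, by ring⟩

/-- The inverse relabelling on even-sum points: `k = −Σ/2`, `i = −x₁ − k`, `j = −x₂ − k`. [folklore] -/
def ofFcc (x : fccSite) : ℤ × ℤ × ℤ :=
  (-(((x : Site 3) 0 + (x : Site 3) 1 + (x : Site 3) 2) / 2),
    -(x : Site 3) 1 + ((x : Site 3) 0 + (x : Site 3) 1 + (x : Site 3) 2) / 2,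
    -(x : Site 3) 2 + ((x : Site 3) 0 + (x : Site 3) 1 + (x : Site 3) 2) / 2)

/-- **The relabelling is a bijection `ℤ³ ≃ D₃`.** [cite: ConwaySloane1999, Ch. 1 §1.4] -/
def fccEquiv : (ℤ × ℤ × ℤ) ≃ fccSite where
  toFun v := ⟨toFcc v, toFcc_mem v⟩
  invFun := ofFcc
  left_inv v := by
    obtain ⟨k, i, j⟩ := v
    simp only [ofFcc, toFcc_zero, toFcc_one, toFcc_two]
    refine Prod.ext ?_ (Prod.ext ?_ ?_) <;> simp only <;> omega
  right_inv x := by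
    obtain ⟨x, hx⟩ := x
    obtain ⟨m, hm⟩ := (mem_fccSite_iff x).1 hx
    apply Subtype.ext
    show toFcc (ofFcc ⟨x, hx⟩) = x
    ext t
    fin_cases t
    · show toFcc (ofFcc ⟨x, hx⟩) 0 = x 0
      rw [toFcc_zero]; simp only [ofFcc]; omega
    · show toFcc (ofFcc ⟨x, hx⟩) 1 = x 1
      rw [toFcc_one]; simp only [ofFcc]; omega
    · show toFcc (ofFcc ⟨x, hx⟩) 2 = x 2
      rw [toFcc_two]; simp only [ofFcc]; omega

/-- `fccEquiv v = toFcc v` as a point of `ℤ³`. [folklore] -/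
@[simp] theorem coe_fccEquiv (v : ℤ × ℤ × ℤ) : ((fccEquiv v : fccSite) : Site 3) = toFcc v := rfl

/-! ## §2 The twelve contacts of the `ABC` stacking are the twelve minimal vectors of `D₃` -/

/-- The twelve contacts of the `ABC` stacking as label differences `(c, a, b) = (k − k', i − i', j − j')`: in the layer (`c = 0`,
`(a, b) ∈ sixOffsets`), to the layer above (`c = −1`, `(a, b) ∈ threeOffsets (−1)`), to the layer below (`c = 1`, `(a, b) ∈ threeOffsets 1`).
[cite: HalesDSP2012, §1.3] -/
def CubicShell (a b c : ℤ) : Prop :=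
  (c = 0 ∧ (a, b) ∈ sixOffsets) ∨ (c = -1 ∧ (a, b) ∈ threeOffsets (-1)) ∨ (c = 1 ∧ (a, b) ∈ threeOffsets 1)

/-- `CubicShell` is decidable (finite table). [folklore] -/
instance instDecidableCubicShell (a b c : ℤ) : Decidable (CubicShell a b c) := by unfold CubicShell; infer_instance

/-- The three-element coordinate range. [folklore] -/
def unitRange : Finset ℤ := {-1, 0, 1}

/-- Membership in `unitRange`. [folklore] -/
theorem mem_unitRange {a : ℤ} (h1 : -1 ≤ a) (h2 : a ≤ 1) : a ∈ unitRange := by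
  simp only [unitRange, Finset.mem_insert, Finset.mem_singleton]; omega

/-- The finite core: on `{−1,0,1}³` the quadratic shell equation and the contact table agree (checked by `decide`). [folklore] -/
theorem sq_eq_two_iff_shell_fin : ∀ a ∈ unitRange, ∀ b ∈ unitRange, ∀ c ∈ unitRange,
    ((a + b) ^ 2 + (a + c) ^ 2 + (b + c) ^ 2 = 2 ↔ CubicShell a b c) := by
  decide

/-- **The shell in stacking coordinates**: `|toFcc d|² = (a+b)² + (a+c)² + (b+c)² = 2` iff `(c, a, b)` is one of the twelve `ABC` contacts. [cite: ConwaySloane1999, Ch. 4 §7.1] -/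
theorem sq_eq_two_iff_shell (a b c : ℤ) : (a + b) ^ 2 + (a + c) ^ 2 + (b + c) ^ 2 = 2 ↔ CubicShell a b c := by
  constructor
  · intro h
    have hab : (a + b) ^ 2 ≤ 2 := by nlinarith [sq_nonneg (a + c), sq_nonneg (b + c)]
    have hac : (a + c) ^ 2 ≤ 2 := by nlinarith [sq_nonneg (a + b), sq_nonneg (b + c)]
    have hbc : (b + c) ^ 2 ≤ 2 := by nlinarith [sq_nonneg (a + b), sq_nonneg (a + c)]
    have h1 : -1 ≤ a + b ∧ a + b ≤ 1 := by constructor <;> nlinarith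
    have h2 : -1 ≤ a + c ∧ a + c ≤ 1 := by constructor <;> nlinarith
    have h3 : -1 ≤ b + c ∧ b + c ≤ 1 := by constructor <;> nlinarith
    exact (sq_eq_two_iff_shell_fin a (mem_unitRange (by omega) (by omega)) b (mem_unitRange (by omega) (by omega)) c
      (mem_unitRange (by omega) (by omega))).1 h
  · intro h
    have hb : -1 ≤ a ∧ a ≤ 1 ∧ -1 ≤ b ∧ b ≤ 1 ∧ -1 ≤ c ∧ c ≤ 1 := by
      rcases h with ⟨hc, hm⟩ | ⟨hc, hm⟩ | ⟨hc, hm⟩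
      · have := sixOffsets_coord _ hm; simp only at this; omega
      · have := threeOffsets_coord _ _ hm; simp only at this; omega
      · have := threeOffsets_coord _ _ hm; simp only at this; omega
    exact (sq_eq_two_iff_shell_fin a (mem_unitRange hb.1 hb.2.1) b (mem_unitRange hb.2.2.1 hb.2.2.2.1) c
      (mem_unitRange hb.2.2.2.2.1 hb.2.2.2.2.2)).2 h

/-- The `ABC` contact graph's shell is `CubicShell` of the label differences (`−constHagg k = −1`, `constHagg (k−1) = 1`). [cite: HalesDSP2012, §1.3] -/
theorem contactGraph_constHagg_adj_iff (k i j k' i' j' : ℤ) :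
    (contactGraph constHagg).Adj (k, i, j) (k', i', j') ↔ CubicShell (i - i') (j - j') (k - k') := by
  rw [contactGraph_adj_iff isHaggSeq_const, CubicShell]
  simp only [constHagg]
  have e1 : k' = k ↔ k - k' = 0 := by omega
  have e2 : k' = k + 1 ↔ k - k' = -1 := by omega
  have e3 : k' = k - 1 ↔ k - k' = 1 := by omega
  rw [e1, e2, e3]

/-- The squared cubic-frame distance between two balls in stacking coordinates. [folklore] -/
theorem sum_sq_toFcc_sub (v w : ℤ × ℤ × ℤ) :
    ∑ t, (toFcc v t - toFcc w t) ^ 2 =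
      (v.2.1 - w.2.1 + (v.2.2 - w.2.2)) ^ 2 + (v.2.1 - w.2.1 + (v.1 - w.1)) ^ 2 + (v.2.2 - w.2.2 + (v.1 - w.1)) ^ 2 := by
  rw [Fin.sum_univ_three, toFcc_zero, toFcc_one, toFcc_two, toFcc_zero, toFcc_one, toFcc_two]
  ring

/-- **The fcc lattice IS the contact graph of the cubic close packing**: the relabelling `fccEquiv` is a graph isomorphism
`Barlow.contactGraph constHagg ≃g fccGraph`. [cite: ConwaySloane1999, Ch. 1 §1.3–§1.4] [cite: HalesDSP2012, §1.3] -/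
def fccIso : contactGraph constHagg ≃g fccGraph where
  toEquiv := fccEquiv
  map_rel_iff' := by
    rintro ⟨k, i, j⟩ ⟨k', i', j'⟩
    rw [fccGraph_adj, coe_fccEquiv, coe_fccEquiv, sum_sq_toFcc_sub, contactGraph_constHagg_adj_iff, ← sq_eq_two_iff_shell]
    simp only
    constructor
    · exact fun h => h.2
    · intro h
      refine ⟨fun heq => ?_, h⟩
      have h0 : ∑ t, (toFcc (k, i, j) t - toFcc (k', i', j') t) ^ 2 = 0 := by
        rw [heq]; simp
      rw [sum_sq_toFcc_sub] at h0
      simp only at h0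
      omega

/-- `fccIso v = toFcc v` as a point of `ℤ³`. [folklore] -/
@[simp] theorem coe_fccIso (v : ℤ × ℤ × ℤ) : ((fccIso v : fccSite) : Site 3) = toFcc v := rfl

/-! ## §3 The `3C` member of TARGET 2t′ is a theorem -/

/-- **`θ_v(p_c(v)) = 0` at every ball of the contact graph of the cubic close packing `ABCABC…`** — the `3C` member of
`BarlowStackingCriticalContinuity`, UNCONDITIONAL: transport of the lane's fcc theorem `fcc_criticalContinuity_holds` along `fccIso`.  builds on p205010
(kernel theorem, internal audit signed; external expert review pending).  Not in print. [cite: BenjaminiSchramm1996, Conj. 4] [cite: ConwaySloane1999, Ch. 1 §1.3] -/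
theorem cubic_criticalContinuity (v : ℤ × ℤ × ℤ) :
    theta (contactGraph constHagg) v (criticalProbIOf (contactGraph constHagg) v) = 0 := by
  have hc : criticalProbIOf (contactGraph constHagg) v = criticalProbIOf fccGraph (fccIso v) :=
    Subtype.ext (criticalProb_iso fccIso v).symm
  rw [hc, ← theta_iso fccIso v]
  exact fcc_criticalContinuity_holds (fccIso v)

/-- The same at the cubic-close-packing ball `(0,0,0)`, in the shape of the lane's `FccOwnCriticalContinuity`. [cite: BenjaminiSchramm1996, Conj. 4] -/
theorem cubic_ownCriticalContinuity :
    theta (contactGraph constHagg) ((0 : ℤ), (0 : ℤ), (0 : ℤ)) (criticalProbIOf (contactGraph constHagg) ((0 : ℤ), (0 : ℤ), (0 : ℤ))) = 0 :=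
  cubic_criticalContinuity _

end Barlow

end Summit.CriticalPhenomena.PercolationContinuityZ3.Theorems.Transplant

end
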